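import Mathlib
import HarnessLib
import HarnessLib.Audit
import Summits.CriticalPhenomena.Statement
import Literature.Probability.Percolation.BoxCrossing
import Literature.Probability.Percolation.SmirnovTheorem
import Literature.Probability.Percolation.SmirnovContinuumLimit
import Literature.Probability.Percolation.SeparatingEvents
import HarnessLib.Audit.Status.Attr

/-!
Route: CardyDiscreteHolo

DORMANT since 2026-08-22T21:46:05Z (reconciler: no traction for 5.7 d (last activity item-evidence-added at 2026-08-17T04:38:32Z); parked, not closed — `ledger route dormant route-CriticalPhenomena-CardyDiscreteHolo --off` to reactivate) — unstaffed, not closed; items shared with open routes are served there. `ledger route dormant <id> --off` reactivates.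

It suffices to show X = BOND SEPARATING FAMILIES (item CardyDiscreteHoloThesis, typed; the bond-ℤ²
analogue of the discrete half (D) = Literature smirnov_exists_separatingFamilies of the tree's proof
of Smirnov's theorem): for every conformal rectangle R = (Ω; a′, b′, c′, d′) and every Carleson
datum (a, b, c, d, ψ) — abc a non-degenerate equilateral triangle, d ∈ (c, a), ψ : Ω → Δ conformal
with boundary values a, b, c, d at the marks (IsCarlesonMap) — there are δ₀ > 0 and two Smirnov
separating families g⁻, g⁺ (Literature IsSmirnovFamily R a b c δ₀: continuous [0,1]-valued on
closure Ω, uniformly equicontinuous uniformly in δ = B–R Claim 22, every subsequential uniform limit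
satisfying the contour relation (36) on lattice triangles with ω = triangleTurn a b c and the
boundary values (37)), points z⁻_δ, z⁺_δ → d′ in Ω and an error e(δ) → 0 with g⁻_δ¹(z⁻_δ) − e(δ) ≤
bondDomainCrossingProb R δ ≤ g⁺_δ¹(z⁺_δ) + e(δ) for 0 < δ < δ₀. The continuum half is
lattice-agnostic and PROVED in the tree (IsSmirnovFamily.tendsto_apply_one with
triangleIntegral_eq_zero_of_forall_lattice_holds, smirnov_claim24_holds, exists_isCarlesonMap_holds,
cardyFunction_crossRatio_eq_carlesonRatio_holds), so X → CardyFormulaZ2 (support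
CardyDiscreteHoloR3Transfer) is provable now. X is attacked through TWO SCALAR CONSERVATION LAWS for
Smirnov's own bond-ℤ² separating probabilities H^δ_α = bondSeparatingProb T α δ
(SeparatingEvents.lean: an open self-avoiding path of Ω_δ joins the two discrete arcs adjacent to
T.pt α and separates nearestSite δ z from the opposite arc): crux CardyDiscreteHoloR2Construction
(rank 2; in every conformal triangle with a Carleson-type ψ onto an equilateral abc, every locally
uniform subsequential limit G of (H^δ_{i+2})ᵢ has G⁰ + ωG¹ + ω²G² conservative on Ω) and crux
BondSumRule (rank 3; H^δ_0 + H^δ_1 + H^δ_2 → 1 locally uniformly on Ω). For the contour integrals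
S_i = ∮G^i the two laws say ΣS_i = 0 and Σωⁱ S_i = 0, whose solution line is S ∝ (1, ω, ω²), i.e.
exactly Bollobás–Riordan's (36) S_{i+1} = ωS_i; the support BondFamiliesOfConservationLaws ports B–R
Ch. 7 §7.2.2–7.2.6 to bond-ℤ² with the colour-switching Lemmas 12–13 replaced by the two laws
(interpolation and Claim-22 equicontinuity on closure Ω by RSW over Lemma-14 discrete domains, (37a)
Gⁱ = 0 on Aᵢ by RSW, (37b) G^{i+1}+G^{i+2} = 1 on Aᵢ from the sum rule plus continuity on the
closure, the (40) link near d′).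
Lean: X := CardyDiscreteHoloThesis; deciding theorem closes : CardyDiscreteHoloR2Construction →
BondSumRule → BondFamiliesOfConservationLaws → CardyDiscreteHoloR3Transfer → CardyFormulaZ2 := fun
hR2 hSum hFam hEnd => hEnd (hFam hR2 hSum) (certified native, rev 4; unchanged and re-certified at
revs 11–14, route-choice repair 2026-08-16: since then every arrow is a NAMED item —
BondFamiliesOfConservationLaws := CardyDiscreteHoloR2Construction → BondSumRule →
CardyDiscreteHoloThesis, CardyDiscreteHoloR3Transfer := CardyDiscreteHoloThesis → CardyFormulaZ2 —
so the target X is reached and consumed by name, and Assembly := CardyDiscreteHoloR2Construction →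
BondSumRule → CardyFormulaZ2).

Rationale: WHY THIS LINE. This is Smirnov's own proof architecture (Smirnov2001 Thm 1;
SmirnovPercolationLong2009 = arXiv:0909.4499 §2; BollobasRiordan2006 Ch. 7; BeffaraUniversal2008 on
what transplants to other lattices: everything except the exact vanishing ψ ≡ 0 of the discrete
contour sums, which uses colour switching and the 2π/3 symmetry of 𝕋; Schramm2007ICM Problem 2.11 is
the target). The tree already contains the lattice-agnostic endgame PROVED (IsSmirnovFamily,
Arzelà–Ascoli, Morera for lattice triangles, Claim 24 uniqueness, Carleson maps, the Cardy–Carleson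
identity), and the ℤ² observables are DEFINED (bondSeparatingProb). So the whole ℤ² difficulty is
isolated in typed, refutable statements about specific percolation quantities, with no posited
interface and no transport crux: the two scalar conservation laws (parafermionic conservativity of
G⁰ + ωG¹ + ω²G² for subsequential limits; the sum rule ΣH^δ_α → 1), whose conjunction is (36). The
bet is that the two scalar laws can be attacked separately — the sum rule first, by self-duality of
bond-ℤ² at 1/2 (flip∘shift is an exact symmetry) plus RSW continuity, the conservativity law by a
global rearrangement / discrete-harmonicity argument for H^δ_α on the medial lattice
(DKKMO2020Rotational = arXiv:2012.11672 rotation invariance is the nearest structural input) — where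
the full vector identity has no known ℤ² mechanism. Areas imported: discrete complex analysis and
Riemann–Hilbert boundary problems (Morera limit laws), planar percolation (RSW, duality); no
spectral or probabilistic reformulation beyond that.

RANKED CRUXES. r0 target CardyDiscreteHoloThesis (X, typed over IsSmirnovFamily and
bondDomainCrossingProb; per rectangle EQUIVALENT to Cardy(R) because the δ-constant continuum triple
hⁱ∘ψ inhabits IsSmirnovFamily — refuters g41-25/g41-39 — so X is a waypoint carrying no discrete
content of its own). r2 CardyDiscreteHoloR2Construction — the ℤ² Morera law: conservativity on Ω of
G⁰ + ωG¹ + ω²G² for every locally uniform subsequential limit of the bond separating probabilities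
(hardest: no colour switching on ℤ²; Beffara's naive defect sum diverges like δ^(-1/3); the
ψ/HasBoundaryValue hypotheses are decoration, only IsEquilateral matters, fixing ω = triangleTurn a
b c). r3 BondSumRule — ΣH^δ_α → 1 locally uniformly on Ω (open even on 𝕋 short of the full
Cauchy–Riemann structure; on ℤ² its boundary trace is equivalent to asymptotic agreement of primal
and dual = δ/2-shifted crossing probabilities of the sub-rectangles (pt i, z, pt i+1, pt i+2), z ∈
Aᵢ, so it also carries the second half of the boundary law (37)). Supports:
CardyDiscreteHoloR3Transfer (X → CardyFormulaZ2, stated BY NAME as CardyDiscreteHoloThesis →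
CardyFormulaZ2 since rev 12, item stmt-CriticalPhenomena-14248; provable now from the tree —
candidate sorry-free proofs are attached as refuter evidence on the retired predecessor
stmt-CriticalPhenomena-0710: Proofs14.lean, P20.lean, CDHGlue.lean, valid verbatim for the
renamed-by-restate decl since the two forms are definitionally equal);
CardyDiscreteHoloR4HolderApriori (interior asymptotic equicontinuity of H^δ_α uniformly in small δ,
from rsw_half_holds + annulus bounds; M/L); CardyDiscreteHoloR5Nondegenerate (= Literature
discreteCrossingProb_clusterPt_mem_Ioo, proved in tree as
discreteCrossingProb_clusterPt_mem_Ioo_holds: closes by citation); BondFamiliesOfConservationLaws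
(r2 → BondSumRule → X: the B–R Ch. 7 port, XL, lattice-agnostic given the two cruxes; stated BY NAME
as CardyDiscreteHoloR2Construction → BondSumRule → CardyDiscreteHoloThesis since rev 11, item
stmt-CriticalPhenomena-14143). ROUTE-CHOICE REPAIR 2026-08-16 (operator hold target-unreachable on
X; option (a) glue Crux… → X): until rev 10 both glue supports inlined the Props, so by name nothing
concluded or consumed the target; revs 11–12 restated them 1:1 over the route's own decl names
(definitionally equal, rfl), making the by-name item graph r2, BondSumRule
→[BondFamiliesOfConservationLaws]→ X →[CardyDiscreteHoloR3Transfer]→ CardyFormulaZ2 with the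
deciding theorem closes = hEnd (hFam hR2 hSum) unchanged (native OK, axioms propext /
Classical.choice / Quot.sound). Assembly (rev 13, stmt-CriticalPhenomena-14347) = r2 → BondSumRule →
CardyFormulaZ2, the route's claim 'the two conservation laws give Cardy on bond-ℤ²' — it is NOT a
hypothesis of closes and is proved by composing the two supports once they land (the rev-6 four-item
chain had become a tautology after the renaming and was flagged ground.trivial by h21_ground). NOTE
on the file: the informal glosses in the docstrings of CardyDiscreteHoloThesis, R2Construction and
R4HolderApriori predate rev 3 and describe the retired posited interface CardySmirnovScheme (defn
p3535, never landed); their TYPED statements and this paragraph are authoritative (refreshing a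
gloss needs --restate, which replaces the item and orphans its stamps and evidence, so it is not
done for the two vetted cruxes and the target).
#0 CardyDiscreteHoloThesis (target) — X = bond separating families: for every conformal rectangle
with a Carleson datum, two Smirnov separating families (IsSmirnovFamily) sandwich
bondDomainCrossingProb near d′ up to e(δ) → 0 (bond analogue of B–R (D)
smirnov_exists_separatingFamilies). (why it might fail: Per rectangle it is EQUIVALENT to Cardy(R)
(the δ-constant continuum triple hⁱ∘ψ inhabits IsSmirnovFamily; refuters g41-25/39), so it fails
exactly if bond-ℤ² crossing probabilities are not universal (unrefereed claim arXiv:2206.04599); no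
ℤ² construction of the families is in print.) [BollobasRiordan2006, Smirnov2001,
SmirnovPercolationLong2009, Zhang2022CrossingSquareLattice]
#2 CardyDiscreteHoloR2Construction (crux) — the ℤ² Morera law: in every conformal triangle with a
Carleson-type ψ onto an equilateral abc, every locally uniform subsequential limit G of the bond
separating probabilities (H^δ_(i+2))ᵢ has G⁰ + ωG¹ + ω²G² conservative on Ω, ω = triangleTurn a b c.
[difficulty: open-problem] (why it might fail: ℤ² has neither colour switching nor 2π/3 symmetry, so
no discrete identity backs conservativity of G⁰+ωG¹+ω²G² (Beffara: the ψ-defect sum diverges like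
δ^(-1/3)); it holds iff the 3-arc separating probabilities are universal — false if Zhang
arXiv:2206.04599 were right.) [BeffaraUniversal2008, SmirnovPercolationLong2009,
BollobasRiordan2006, Schramm2007ICM, Zhang2022CrossingSquareLattice, DKKMO2020Rotational]
#3 BondSumRule (crux) — the sum rule: for every conformal triangle T, H^δ_0 + H^δ_1 + H^δ_2 → 1
locally uniformly on Ω as δ → 0⁺ (H^δ_α = bondSeparatingProb T α δ). [difficulty: open-problem] (why
it might fail: No mechanism even on 𝕋 short of Smirnov's full CR structure; its boundary trace
already needs primal and dual (δ/2-shifted) crossing probabilities of sub-rectangles to agree as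
δ→0; MC at a triangle centre gives 1.026(22) at n=128 (g41-39), so only a trend persisting under
refinement kills it.) [BollobasRiordan2006, SmirnovPercolationLong2009, Grimmett2018,
SchrammSmirnov2011, arXiv:cond-mat/0605120]
#9 CardyDiscreteHoloR3Transfer (support) — CardyDiscreteHoloThesis → CardyFormulaZ2 by name (the
endgame: squeeze through IsSmirnovFamily.tendsto_apply_one and the proved (B), (C), (M), (U));
candidate proofs attached as evidence on the retired predecessor stmt-CriticalPhenomena-0710.
[difficulty: provable-now] [BollobasRiordan2006, Smirnov2001]
#9 CardyDiscreteHoloR4HolderApriori (support) — interior asymptotic equicontinuity of H^δ_α on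
compacts, uniformly in small δ (RSW). [difficulty: M] [BollobasRiordan2006,
SmirnovPercolationLong2009, Grimmett2018]
#9 CardyDiscreteHoloR5Nondegenerate (support) — cluster points of ℤ² crossing probabilities of
conformal rectangles at p = 1/2 lie in (0,1) — the Literature fact, proved in tree (closes by
citation). [difficulty: provable-now] [GrimmettPercolation1999, BollobasRiordan2006]
#9 BondFamiliesOfConservationLaws (support) — the B–R Ch. 7 port: CardyDiscreteHoloR2Construction →
BondSumRule → CardyDiscreteHoloThesis by name (interpolation, Claim-22 equicontinuity on the
closure, (37a) by RSW, (37b) from the sum rule, (36) by linear algebra, the (40) link). [difficulty: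
XL] [BollobasRiordan2006, SchrammSmirnov2011, SmirnovPercolationLong2009]

TWO-LAYER PLAN. Foreseen only, filed when a crux moves (k ≤ 3, depth 1):
BondFamiliesOfConservationLaws ⇐ BondClosureEquicontinuity (B–R Claim 22 analogue: the interpolants
(32)–(34) of H^δ_α over Lemma-14 discrete domains are equicontinuous on closure Ω uniformly in δ,
RSW only) → BondBoundaryVanishing ((37a): every closure-uniform subsequential limit has Gⁱ = 0 on
Aᵢ, RSW one-arm at the boundary + Jordan topology) → BondCrossingLink ((40): bondDomainCrossingProb
R δ = g_δ¹(z_δ) + o(1) for some z_δ → d′) → BondFamiliesOfConservationLaws, the remaining glue being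
linear algebra ((ΣS_i = 0 ∧ Σωⁱ S_i = 0) ⇒ S ∝ (1, ω, ω²) = (36)) and (37b) from BondSumRule + (37a)
+ continuity on the closure. CardyDiscreteHoloR2Construction ⇐ (conservativity on lattice RECTANGLES
of the medial-lattice observable) → (rectangles ⇒ IsConservativeOn via Mathlib's
isConservativeOn_and_continuousOn_iff_isDifferentiableOn) only if a discrete mechanism appears; none
is filed now.

KILL CRITERIA. A theorem ¬CardyDiscreteHoloR2Construction (e.g. a no-go: some subsequential limit in
some conformal triangle has a non-conservative G⁰ + ωG¹ + ω²G², or no finite-range linear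
combination of increasing arm events on ℤ² has o(1) Morera defect in all domains AND the limit law
fails) closes the route refuted:CardyDiscreteHoloR2Construction; pivot = sibling routes
CardyHarmonicInvariants / UnionJackBeffara / CardyRotToConf. A theorem ¬BondSumRule closes it
refuted:BondSumRule (Monte-Carlo deviation of ΣH^δ_α at an interior point is evidence, not a close).
Refuting R3Transfer is impossible without refuting the proved uniqueness (Claim 24). CardyFormulaZ2
proved on any other route moots this one; a refereed disproof of ℤ² crossing universality (cf. the
unrefereed claims Zhang2022CrossingSquareLattice = arXiv:2206.04599 against, Zhou2024SLE6BondZ2 =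
arXiv:2409.03235 for, the latter resting on a non-rigorous half-plane exponent) kills X itself.

NOT DECOMPOSED YET. The internals of BondFamiliesOfConservationLaws beyond the foreseen three
children (discrete approximation of the Jordan domain = B–R Lemma 14 analogue over meshDomain /
discreteArc; McShane interpolation; the inner/outer sandwich (19)); rates in either law;
medial-lattice versus vertex discretisation of H^δ_α; any parafermionic (spin 1/3) identification of
F; the typing artefact of bondSeparatingEvent measured by refuter g41-39 (vertex-separation by
γ.support versus intrinsic/dual separation differ by ≤ 0.004 at n = 16…128, a 6-arm gate
configuration, O(n^-1/4) → 0, so limits and both cruxes are unaffected; a topological re-definition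
of separation is optional and NOT requested). Correction to rev 6: the flip∘shift + shift-stability
step is NOT needed inside the port — (37b) follows from BondSumRule — it is where self-duality would
enter a PROOF of BondSumRule at the boundary.

CHEAPEST FALSIFIER. (i) ΣH^δ_α at an interior point — RUN by refuter g41-39 (evidence
SumRule_mc_evidence.md on stmt-CriticalPhenomena-8934; kit job j001760 queued for n ≤ 512): at the
centre of the square conformal triangle {0..n}² with pt0 = (0,0), pt1 = (n,0), pt2 = (n/2,n),
bond-ℤ² at p = 1/2, ΣH^δ_α = 1.303(69), 1.139(15), 1.091(14), 1.036(14), 1.026(22) for n = 8, 16,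
32, 64, 128 — monotone decrease towards 1 with an n^(-2/3…-1) finite-size excess; kill criterion NOT
met. Next cheapest: (ii) the lattice contour sum of F_δ = H^δ_0 + ωH^δ_1 + ω²H^δ_2 around a fixed
interior circle of the unit disc with marks at angles 0, 2π/3, 4π/3, normalised by Σ|increments|, δ
= 2^-6 … 2^-9 (R2 predicts → 0; on 𝕋 the same normalised sum → 0 by Smirnov's colour-switching
identity, so a site-𝕋 run at equal δ calibrates the estimator); (iii) for BondSumRule's boundary
trace, primal-versus-dual crossing probabilities of one non-smooth Jordan sub-rectangle at δ and
δ/2-shift (difference predicted → 0). Not run in this seat (route-repair one-shot, compute queue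
congested per g41-50).

NUMBERS. ΣH^δ_α at the centre of the square triangle (bond-ℤ², p = 1/2; refuter g41-39, evidence on
stmt-CriticalPhenomena-8934): n = 8: 1.303(69); 16: 1.139(15); 32: 1.091(14); 64: 1.036(14); 128:
1.026(22); predicted limit 1 (on 𝕋: hⁱ = barycentric coordinates, each → 1/3 at the centroid of an
equilateral T). Vertex- vs intrinsic-separation discrepancy of bondSeparatingEvent: ≤ 0.004 (n =
16…128). Cardy–Carleson value h¹(d) = |d − c|/|a − c| (carlesonLinear_one_eq_carlesonRatio).

DEFINITION REQUESTS. None: bondSeparatingProb (SeparatingEvents.lean), IsSmirnovFamily /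
IsCarlesonMap / triangleTurn (SmirnovContinuumLimit.lean, SmirnovTheorem.lean),
bondDomainCrossingProb and cardyFunction all exist; the retired request CardySmirnovScheme (p3535)
is superseded by IsSmirnovFamily.

Novelty: Searches (2026-08-15, seats rrepair-0 / rbadge-g4 / rbadge-g5): lit search --hybrid "Cardy formula
bond percolation square lattice separating probabilities discrete Cauchy-Riemann" (12 local docs:
BollobasRiordan2006, Grimmett1999, Grimmett2018, Kesten1982 …); lit search "Cardy formula critical
bond percolation square lattice conformal invariance proof" --year-from 2010 (13 local + 16 remote:
arXiv:1112.2017 Tsai–Yam–Zhou SLE₆-on-bond-ℤ² claim, DKKMO2020Rotational = arXiv:2012.11672,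
arXiv:2203.08167 Camia, Beliaev–Izyurov factorization observables on 𝕋
doi:10.1007/s00220-011-1335-5, GoriViti2018 = arXiv:1806.02330); lit search --hybrid "probability
that a point is connected to a boundary segment Kleban Simmons Ziff" (12: SmirnovPercolationLong2009
= arXiv:0909.4499, Smirnov2001, Kleban–Ziff segment-cluster counts); lit galaxy search "universality
of crossing probabilities" --star all (12 rows: Bollobás–Riordan, Simmons–Kleban–Ziff cluster
densities arXiv:1103.5691, Maier math-ph/0210013, Pruessner–Moloney cond-mat/0309126); lit galaxy
search "Cardy's formula for bond percolation on the square lattice" --star all (0 rows); lit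
frontier CriticalPhenomena --since 2021 (30 descendants, none on ℤ² Cardy; arXiv:2605.04395 anchored
clusters / SLE excursions nearest in theme); ledger negatives --problem CriticalPhenomena (1 SAW
statement, unrelated to CardyFormulaZ2); references.bib checked for the two unrefereed ℤ² claims
Zhang2022CrossingSquareLattice (arXiv:2206.04599, "Cardy fai  [refs: 10.1007/s00220-011-1335-5, 1112.2017, 2012.11672, 2203.08167, 1806.02330, 0909.4499, 1103.5691, 2605.04395, 2206.04599, 2409.03235, doi:10.1007/s00220-011-1335-5, BollobasRiordan2006, Grimmett1999, Grimmett2018, Kesten1982, GoriViti2018, SmirnovPercolationLong2009, Smirnov2001, BeffaraUniversal2008]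

Barriers (technique_class: smirnov-harmonic-triple, morera-limit-law, self-duality): - technique_class: smirnov-harmonic-triple, morera-limit-law, self-duality
- Literature.Barriers.CriticalPhenomena.SmirnovTriangularOnly: it does not evade it at the level of
mechanism — the barrier blocks the verbatim ψ ≡ 0 transplant (exact vanishing of discrete contour
sums from colour switching alone), and this route asks only for the LIMIT laws (IsConservativeOn of
the limit, ΣH → 1), which the barrier's scope_caveats leave open; the bet is that the two scalar
laws can be attacked separately (sum rule first, by self-duality + continuity) where the full vector
identity cannot.
- Literature.Barriers.CriticalPhenomena.FKParafermionicHalfCauchyRiemann: applies to ONE natural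
attack on CardyDiscreteHoloR2Construction (identify F as the q = 1 FK edge parafermion and use
vertex relations + boundary values): blocked at the discrete level (plaquette kernel); the route's F
is Smirnov's separation combination, and only its limit law is asked, obtained on 𝕋 by global
rearrangement not local relations (the barrier's evasion (v)).
- Literature.Barriers.CriticalPhenomena.CoveringLatticeShift: the sharpened block kills exact
identities using the type-exchange or the colour flip ALONE; a proof of BondSumRule at the boundary
would use flip∘shift (an exact symmetry of bond-ℤ² at 1/2, the barrier's recorded residual) composed
with mesh-uniform stability of crossing probabilities under the δ/2 shift — a rate-free o(1)
statement, outside the blocked class; the cruxes themselves posit no ident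

Novelty grade: variant — refuter route-review (rreview1): claimed new-combination; graded VARIANT. Nearest prior art (read on held text): BeffaraUniversal2008 §3, arXiv p.12 — the route's two scalar laws ARE Beffara's pair: R2Construction = limit form of (3.3) (h holomorphic iff contour sums of H_δ → 0), BondSumRule = (3.4) (refuter refuter-rreview1-CriticalPhenomena-CardyDiscret-ac6541c9-0, 2026-08-15T18:24:42Z; prior: arXiv:0708.3908 §3 (3.2)-(3.4) p.12; arXiv:0909.4499 Lemma 2.1, Remark 5; BollobasRiordan2006 Ch.7 Claims 22-24 pp.197-201; Smirnov2001 Thm 1; route-CriticalPhenomena-CardyHarmonicInvariants (MoreraOnZ2))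

History (route lifecycle, newest last):
- 2026-08-15T16:16:21Z · rev 6: restated Assembly (stmt-CriticalPhenomena-0708) — restate Assembly over the item NAMES (was the same implication with the four Props inlined, which raised glue.extra-hypothesis); identical in content to the cer (planner-rbadge-CriticalPhenomena-CardyDiscrete-ac6541c9-g4-0)
- 2026-08-16T03:04:34Z · rev 11: restated BondFamiliesOfConservationLaws (stmt-CriticalPhenomena-9340) — route-choice (unit rchoice-CriticalPhenomena-CardyDiscret-2e97a906, option (a) glue Crux… → CardyDiscreteHoloThesis): restate the B–R port BY NAME — BondFamilie (planner-rchoice-CriticalPhenomena-CardyDiscret-2e97a906-0)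
- 2026-08-16T03:11:36Z · rev 12: restated CardyDiscreteHoloR3Transfer (stmt-CriticalPhenomena-0710) — @note_r3.txt (planner-rchoice-CriticalPhenomena-CardyDiscret-2e97a906-0)
- 2026-08-16T03:16:29Z · rev 13: restated Assembly (stmt-CriticalPhenomena-10465) — @note_asm.txt (planner-rchoice-CriticalPhenomena-CardyDiscret-2e97a906-0)
- 2026-08-22T21:46:05Z · DORMANT — reconciler: no traction for 5.7 d (last activity item-evidence-added at 2026-08-17T04:38:32Z); parked, not closed — `ledger route dormant route-CriticalPhenomen (operator:999:2391307)

sub-problem: CardyFormulaZ2 · status: dormant · opened planner-CriticalPhenomena-Survey-0 2026-08-13T13:27:20Z · rev 15 · ledger route-CriticalPhenomena-CardyDiscreteHolo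
GENERATED by the gate from the ledger (D-0016/17). Provers cite these decls: `theorem foo : Summit.CriticalPhenomena.CardyFormulaZ2.Theses.CardyDiscreteHolo.<Decl> := …` in Summits/CriticalPhenomena/CardyFormulaZ2/Theorems/<Name>.lean.
-/

namespace Summit.CriticalPhenomena.CardyFormulaZ2.Theses.CardyDiscreteHolo

open scoped BigOperators Topology Manifold Classical MeasureTheory ProbabilityTheory Matrix InnerProductSpace ComplexConjugate ContinuousMap
open Filter Set Function TopologicalSpace MeasureTheory

attribute [summit_statement] _root_.CardyFormulaZ2

/-- item stmt-CriticalPhenomena-0707 · target · rank 0 · open · by planner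
why it might fail: Per rectangle it is EQUIVALENT to Cardy(R) (the δ-constant continuum triple hⁱ∘ψ inhabits IsSmirnovFamily; refuters g41-25/39), so it fails exactly if bond-ℤ² crossing probabilities are not universal (unrefereed claim arXiv:2206.04599); no ℤ² construction of the families is in print.
sources: BollobasRiordan2006, Smirnov2001, SmirnovPercolationLong2009, Zhang2022CrossingSquareLattice
X_C2 (informal until defn CardySmirnovScheme lands): for every conformal triangle (Ω; a1,a2,a3) with
a fourth marked boundary point d, bond percolation on δZ^2 at p=1/2 admits a Cardy–Smirnov
observable scheme (H^δ_1,H^δ_2,H^δ_3 : Ω_δ → [0,1]) satisfying (S1) Cardy–Carleson boundary values,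
(S2) uniform Hölder equicontinuity, (S3) vanishing Morera defect of F_δ = Σ τ^{j-1} H^δ_j and of Σ
H^δ_j along every fixed smooth loop, (S4) H^δ_3(d_δ) = bondDomainCrossingProb + o(1). Intended Lean
shape: ∃ (S : CardySmirnovScheme R), True for every R : ConformalRectangle — existence is asserted
HERE, not in the structure. -/
@[route_item "route-CriticalPhenomena-CardyDiscreteHolo"]
def CardyDiscreteHoloThesis : Prop :=
  ∀ (R : Literature.Probability.RandomPlanarGeometry.ConformalRectangle) (a b c d : ℂ) (ψ : Literature.Probability.RandomPlanarGeometry.ConformalEquiv R.carrier (Literature.Probability.Percolation.openTriangle a b c)), Literature.Probability.Percolation.IsEquilateral a b c → d ∈ openSegment ℝ c a → Literature.Probability.Percolation.IsCarlesonMap R a b c d ψ → ∃ δ₀ > (0 : ℝ), ∃ gm gp : ℝ → Fin 3 → ℂ → ℝ, Literature.Probability.Percolation.IsSmirnovFamily R a b c δ₀ gm ∧ Literature.Probability.Percolation.IsSmirnovFamily R a b c δ₀ gp ∧ ∃ (zm zp : ℝ → ℂ) (e : ℝ → ℝ), (∀ δ ∈ Set.Ioo 0 δ₀, zm δ ∈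 R.carrier ∧ zp δ ∈ R.carrier) ∧ Filter.Tendsto zm (nhdsWithin 0 (Set.Ioi 0)) (nhds (R.pt 3)) ∧ Filter.Tendsto zp (nhdsWithin 0 (Set.Ioi 0)) (nhds (R.pt 3)) ∧ Filter.Tendsto e (nhdsWithin 0 (Set.Ioi 0)) (nhds 0) ∧ ∀ δ ∈ Set.Ioo 0 δ₀, gm δ 1 (zm δ) - e δ ≤ Literature.Probability.Percolation.bondDomainCrossingProb R δ ∧ Literature.Probability.Percolation.bondDomainCrossingProb R δ ≤ gp δ 1 (zp δ) + e δ

/-- item stmt-CriticalPhenomena-0709 · crux · rank 2 · open · by planner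
why it might fail: ℤ² has neither colour switching nor 2π/3 symmetry, so no discrete identity backs conservativity of G⁰+ωG¹+ω²G² (Beffara: the ψ-defect sum diverges like δ^(-1/3)); it holds iff the 3-arc separating probabilities are universal — false if Zhang arXiv:2206.04599 were right.
sources: BeffaraUniversal2008, SmirnovPercolationLong2009, BollobasRiordan2006, Schramm2007ICM, Zhang2022CrossingSquareLattice, DKKMO2020Rotational
Crux r2 (CONSTRUCTION; hardest): exhibit, for bond percolation on δZ^2 at 1/2 and every conformal
triangle, functions H^δ_j built from percolation events (on 𝕋: H_j(z) = P[an open simple path from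
arc (a_{j+1}a_{j+2})^c … separates a_j from z]; Smirnov2001) with vanishing Morera defect (S3). The
Z^2 obstruction: the three arms in Smirnov's colour-switching argument alternate primal/dual on Z^2
and the switching bijection fails (Beffara2008 §discussion; Smirnov2001 closing remark). Refuter
sub-task: a no-go statement 'no finite-range linear combination of increasing arm events on Z^2 has
Morera defect o(1) in all domains' would close the route. -/
@[route_item "route-CriticalPhenomena-CardyDiscreteHolo", crux]
def CardyDiscreteHoloR2Construction : Prop :=
  ∀ (T : Literature.Probability.RandomPlanarGeometry.MarkedDomain 3) (a b c : ℂ) (ψ : Literature.Probability.RandomPlanarGeometry.ConformalEquiv T.carrier (Literature.Probability.Percolation.openTriangle a b c)), Literature.Probability.Percolation.IsEquilateral a b c → ψ.HasBoundaryValue (T.pt 0) a → ψ.HasBoundaryValue (T.pt 1) b → ψ.HasBoundaryValue (T.pt 2) c → ∀ (u : ℕ → ℝ) (G : Fin 3 → ℂ → ℝ), (∀ n, 0 < u n) → Filter.Tendsto u Filter.atTop (nhds 0) → (∀ i, ContinuousOn (G i) T.carrier) → (∀ i, TendstoLocallyUniformlyOn (fun n z => Literature.Probability.Percolation.bondSeparatingProb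 T (i + 2) (u n) z) (G i) Filter.atTop T.carrier) → Complex.IsConservativeOn (fun w => (G 0 w : ℂ) + Literature.Probability.Percolation.triangleTurn a b c * (G 1 w : ℂ) + Literature.Probability.Percolation.triangleTurn a b c ^ 2 * (G 2 w : ℂ)) T.carrier

/-- item stmt-CriticalPhenomena-8934 · crux · rank 3 · open · by planner
why it might fail: No mechanism even on 𝕋 short of Smirnov's full CR structure; its boundary trace already needs primal and dual (δ/2-shifted) crossing probabilities of sub-rectangles to agree as δ→0; MC at a triangle centre gives 1.026(22) at n=128 (g41-39), so only a trend persisting under refinement kills it.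
sources: BollobasRiordan2006, SmirnovPercolationLong2009, Grimmett2018, SchrammSmirnov2011, arXiv:cond-mat/0605120
[crux] SUM RULE (rank 3). For every conformal triangle T (MarkedDomain 3), Smirnov's three bond-Z^2
separating probabilities H^δ_α = bondSeparatingProb T α δ (SeparatingEvents.lean; H^δ_α(z) =
P_1/2[an open path of Ω_δ joins the two discrete arcs at the corner T.pt α and separates z from the
opposite arc T.arc (α+1)]) sum to one in the scaling limit, locally uniformly on Ω: H^δ_0 + H^δ_1 +
H^δ_2 → 1 as δ → 0+ (TendstoLocallyUniformlyOn on T.carrier along 𝓝[>]0). Together with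
CardyDiscreteHoloR2Construction (parafermionic conservativity of G0 + ωG1 + ω²G2) this is EXACTLY
Bollobás–Riordan's contour relation (36) for subsequential limits (S_{i+1} = ωS_i for all i iff ΣS_i
= 0 and Σω^iS_i = 0). On site-T it is a theorem only through Smirnov's full Cauchy–Riemann structure
(BollobasRiordan2006 Ch.7 Claim 24: g^i = h^i∘φ, Σh^i = 1). Why it might fail: no mechanism is known
even on T short of the full CR structure; on Z^2 self-duality only trades it for 'open + dual
separation counts have mean 2'; a Monte-Carlo deviation at the centre of a square triangle refutes
it. Sources: BollobasRiordan2006 (Ch.7 Claim 24 p.201, (36)-(37) p.199), arXiv:0909.4499 (§2, Lemma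
2.1, Remark 5), Grimmett2 -/
@[route_item "route-CriticalPhenomena-CardyDiscreteHolo", crux]
def BondSumRule : Prop :=
  ∀ (T : Literature.Probability.RandomPlanarGeometry.MarkedDomain 3), TendstoLocallyUniformlyOn (fun δ z => Literature.Probability.Percolation.bondSeparatingProb T 0 δ z + Literature.Probability.Percolation.bondSeparatingProb T 1 δ z + Literature.Probability.Percolation.bondSeparatingProb T 2 δ z) (fun _ => (1 : ℝ)) (nhdsWithin 0 (Set.Ioi 0)) T.carrier

-- earlier CardyDiscreteHoloR3Transfer (stmt-CriticalPhenomena-0710, replaced 2026-08-16T03:11:36Z -> stmt-CriticalPhenomena-14248): retired by None — (∀ (R : Literature.Probability.RandomPlanarGeometry.ConformalRectangle) (a b c d : ℂ) (ψ : Literature.Probability.RandomPlanarGeometry.ConformalEquiv R.carrier (Literature.Probability.Percolation.openTriangle a b c)), Literature.Probability.Percolation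
/-- item stmt-CriticalPhenomena-14248 · support · rank 3 · open · by planner
sources: BollobasRiordan2006, Smirnov2001
[support] CardyDiscreteHoloR3Transfer (rank 3) — the glue Target → Statement, now stated BY NAME:
CardyDiscreteHoloThesis → CardyFormulaZ2 (route-choice repair 2026-08-16, option (a); the rev-3 form
inlined the Prop of the target, so by name nothing consumed CardyDiscreteHoloThesis; the two forms
are definitionally equal — `rfl` in the planner's Sketch.lean rc0 — so every refuter note and the
three sorry-free CANDIDATE PROOFS attached as evidence on the retired item
stmt-CriticalPhenomena-0710 (P20.lean g41-4, Proofs14.lean g41-39, CDHGlue.lean g40-62; `ledger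
workitem evidence latest stmt-CriticalPhenomena-0710 --all`) apply to this decl verbatim: same decl
name, δ-equal type). Content = the tree's PROVED lattice-agnostic endgame run on
bondDomainCrossingProb (the bond twin of smirnov_tendsto_triDomainCrossingProb_of_limitArgument +
hasCrossingLimit_triDomainCrossingProb_of_carleson): intro hX R φ x hφ; Carleson datum from
exists_isCarlesonMap_holds; rewrite the Cardy value by
cardyFunction_crossRatio_eq_carlesonRatio_holds; unpack the two separating families gm/gp with the
sandwich from hX; both bounds tend to carlesonRatio a c d by IsSmirnovFamily.tendsto_apply_one (with
triangl -/
@[route_item "route-CriticalPhenomena-CardyDiscreteHolo", crux]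
def CardyDiscreteHoloR3Transfer : Prop :=
  CardyDiscreteHoloThesis → CardyFormulaZ2

/-- item stmt-CriticalPhenomena-0711 · support · rank 4 · open · by planner
sources: BollobasRiordan2006, SmirnovPercolationLong2009, Grimmett2018
Crux r4 (a priori regularity, RSW input for (S2)): uniformly in δ ∈ (0,1], the Z^2 crossing
probability of a conformal rectangle is Hölder in the position of one marked point moved along ∂Ω
(w.r.t. harmonic measure / extremal length), and arm-separation probabilities H^δ_j(z) are uniformly
Hölder in z ∈ Ω_δ up to the boundary. Source of the estimate: RSW on Z^2 at 1/2 (Literature fact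
Literature.Probability.Percolation.rsw_half) + quasi-multiplicativity; Grimmett1999 §11.7,
Smirnov2001 §2, Werner2007 §2. Informal: needs a modulus-of-continuity phrasing over
ConformalRectangle. -/
@[route_item "route-CriticalPhenomena-CardyDiscreteHolo"]
def CardyDiscreteHoloR4HolderApriori : Prop :=
  ∀ (T : Literature.Probability.RandomPlanarGeometry.MarkedDomain 3) (α : Fin 3) (K : Set ℂ), IsCompact K → K ⊆ T.carrier → ∀ β > (0 : ℝ), ∃ η > (0 : ℝ), ∃ δ₁ > (0 : ℝ), ∀ δ ∈ Set.Ioo 0 δ₁, ∀ z ∈ K, ∀ w ∈ K, dist z w < η → dist (Literature.Probability.Percolation.bondSeparatingProb T α δ z) (Literature.Probability.Percolation.bondSeparatingProb T α δ w) < β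

/-- item stmt-CriticalPhenomena-0712 · support · rank 5 · open · by planner
sources: GrimmettPercolation1999, BollobasRiordan2006
Sanity/attachment point (Literature statement crit-perc BoxCrossing.lean, consequence of rsw_half):
cluster points of Z^2 crossing probabilities of conformal rectangles at p = 1/2 lie in (0,1). A
grounder should check whether it is already a named fact (then this item closes by citation) — it is
the non-degeneracy half of Cardy and rules out trivial refutations of CardyFormulaZ2 (F(η) ∈ (0,1)). -/
@[route_item "route-CriticalPhenomena-CardyDiscreteHolo"]
def CardyDiscreteHoloR5Nondegenerate : Prop :=
  Literature.Probability.Percolation.discreteCrossingProb_clusterPt_mem_Ioo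

-- earlier BondFamiliesOfConservationLaws (stmt-CriticalPhenomena-9340, replaced 2026-08-16T03:04:34Z -> stmt-CriticalPhenomena-14143): retired by None — (∀ (T : Literature.Probability.RandomPlanarGeometry.MarkedDomain 3) (a b c : ℂ) (ψ : Literature.Probability.RandomPlanarGeometry.ConformalEquiv T.carrier (Literature.Probability.Percolation.openTriangle a b c)), Literature.Probability.Percolation.Is
/-- item stmt-CriticalPhenomena-14143 · support · rank 9 · open · by planner
sources: BollobasRiordan2006, SchrammSmirnov2011, SmirnovPercolationLong2009
[support] BondFamiliesOfConservationLaws (rank 9) — the glue Crux → Crux → Target, now stated BY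
NAME over the route's own decls (route-choice repair 2026-08-16, option (a): the rev-4 form inlined
the three Props, so by name nothing concluded the target CardyDiscreteHoloThesis; the two forms are
definitionally equal, `rfl` in the planner's Sketch.lean rc0, so every earlier refuter note on
stmt-CriticalPhenomena-9340 applies verbatim). Content unchanged = Bollobás–Riordan Ch. 7
§7.2.2–7.2.6 ported to bond-ℤ² with the colour-switching Lemmas 12–13 replaced by the two
hypotheses: discrete approximation of the Jordan domain (Lemma 14 analogue over
meshDomain/discreteArc), RSW equicontinuity of the interpolants on closure Ω uniformly in δ (Claim
22; rsw_half, annulus bounds; interior part = CardyDiscreteHoloR4HolderApriori), boundary values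
(37a) Gⁱ = 0 on Aᵢ by RSW one-arm + Jordan topology, (37b) G^{i+1}+G^{i+2} = 1 on Aᵢ from
BondSumRule + (37a) + continuity on the closure, the contour relation (36) by linear algebra (∮ΣGⁱ =
0 ∧ ∮ΣωⁱGⁱ = 0 ⇒ S ∝ (1, ω, ω²)) with Morera-for-rectangles ⇒ all lattice triangles, the (40) link
bondDomainCrossingProb R δ = g_δ¹(z_δ) + o(1) for some z_δ → d -/
@[route_item "route-CriticalPhenomena-CardyDiscreteHolo", crux]
def BondFamiliesOfConservationLaws : Prop :=
  CardyDiscreteHoloR2Construction → BondSumRule → CardyDiscreteHoloThesis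

-- earlier Assembly (stmt-CriticalPhenomena-0708, replaced 2026-08-15T16:16:21Z -> stmt-CriticalPhenomena-10465): retired by None — (∀ (T : Literature.Probability.RandomPlanarGeometry.MarkedDomain 3) (a b c : ℂ) (ψ : Literature.Probability.RandomPlanarGeometry.ConformalEquiv T.carrier (Literature.Probability.Percolation.openTriangle a b c)), Literature.Probability.Percolation.IsEquilateral a b c → ψ.
-- earlier Assembly (stmt-CriticalPhenomena-10465, replaced 2026-08-16T03:16:29Z -> stmt-CriticalPhenomena-14347): retired by None — CardyDiscreteHoloR2Construction → BondSumRule → BondFamiliesOfConservationLaws → CardyDiscreteHoloR3Transfer → CardyFormulaZ2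
/-- item stmt-CriticalPhenomena-14347 · assembly · rank 1 · open · by planner
[assembly] Assembly (rank 1): the two scalar conservation laws imply Cardy's formula for bond-ℤ² —
CardyDiscreteHoloR2Construction → BondSumRule → CardyFormulaZ2. Restated at the route-choice repair
2026-08-16 (step 3/3): once the two glue supports were stated BY NAME (rev 11
BondFamiliesOfConservationLaws := R2 → BondSumRule → CardyDiscreteHoloThesis; rev 12
CardyDiscreteHoloR3Transfer := CardyDiscreteHoloThesis → CardyFormulaZ2) the rev-6 form `R2 →
BondSumRule → BondFamiliesOfConservationLaws → CardyDiscreteHoloR3Transfer → CardyFormulaZ2` became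
a tautology and h21_ground flagged it ground.trivial (`intros; aesop`), blocking READY; this form
carries the route's actual claim (cruxes → Statement) and is NOT closed by the trivial battery
(planner GroundProbe.lean). It is proved by composing the two supports once they are theorems:
`theorem assembly_holds : Assembly := fun hR2 hSum => r3Transfer_holds (bondFamilies_holds hR2
hSum)` (names indicative) — i.e. it closes exactly when BondFamiliesOfConservationLaws (XL, the B–R
Ch. 7 port) and CardyDiscreteHoloR3Transfer (provable now; candidate proofs on retired
stmt-CriticalPhenomena-0710) have landed. The deciding theorem `closes : C -/
@[route_item "route-CriticalPhenomena-CardyDiscreteHolo"]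
def Assembly : Prop :=
  CardyDiscreteHoloR2Construction → BondSumRule → CardyFormulaZ2

/-! D-0027 §2.1 — DECIDING THEOREM (planner-authored via `route open/edit --closes-file`; by planner-rbadge-CriticalPhenomena-CardyDiscrete-ac6541c9-g4-0 2026-08-15T16:14:07Z):
its hypotheses are this route's items and its conclusion the sub-problem Statement (glue_lint), and it elaborates with this file. -/

@[closes "route-CriticalPhenomena-CardyDiscreteHolo"] theorem closes : CardyDiscreteHoloR2Construction → BondSumRule → BondFamiliesOfConservationLaws → CardyDiscreteHoloR3Transfer → _root_.CardyFormulaZ2 :=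
  fun hR2 hSum hFam hEnd => hEnd (hFam hR2 hSum)

end Summit.CriticalPhenomena.CardyFormulaZ2.Theses.CardyDiscreteHolo
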